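import Literature.Analysis.FunctionSpaces.TorusCalculusProofs
import Literature.Analysis.FunctionSpaces.TorusTestFunction
import Mathlib.MeasureTheory.Measure.Haar.Unique
import Mathlib.MeasureTheory.Group.Measure
import HarnessLib

/-!
# Pull-back of transverse profiles to `𝕋^d` along integer transverse forms of a lattice direction

Third file of the Mikado-flow construction for the convex-integration step of
A. Cheskidov, X. Luo, *Sharp nonuniqueness for the Navier–Stokes equations*, Invent. Math. 229
(2022) = arXiv:2009.06596, §4.1, Thm. 4.3: there `ψ_k(x) = μ^{(d-1)/2} ψ(μ dist(l_k, x))` is a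
function of the DISTANCE to a periodic line in direction `k ∈ ℤ^d`. Here (same objects up to the
choice of transverse profile) a function of `𝕋^d` constant along `k` is produced as the pull-back
`G ∘ L` of a function `G` on a lower-dimensional torus `𝕋^m` along a continuous surjective group
homomorphism `L : 𝕋^d → 𝕋^m` given by INTEGER transverse forms annihilating `k`:

* `TransverseDatum d m` — the integer data: forms `A : d → m → ℤ` (`(L y)_{l'} = ∑ₗ A l l' yₗ`),
  weights `c` with **orthogonal rows** `∑ₗ A l l' A l l'' = δ_{l'l''} c_{l'}`, the direction `k`
  with `∑ₗ A l l' kₗ = 0`, and an integer section `B` (`BA = 1`, so `L` is onto);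
* `TransverseDatum.hom` (the homomorphism `L`, continuous, surjective), `TransverseDatum.lin`
  (its real-linear lift `L̃`, `L (proj y) = proj (L̃ y)`), `TransverseDatum.pull G = G ∘ L`;
* calculus of pull-backs in the torus vocabulary of `TorusCalculus`: `lift (G ∘ L) = lift G ∘ L̃`,
  smoothness (`isSmooth_pull`), the **chain rule** `D(G ∘ L)(x) = DG(Lx) ∘ L̃` (`fderiv_pull`),
  **invariance along `k`** (`fderiv_pull_dir`), `∂ₗ(G ∘ L) = ∑_{l'} A l l' (∂_{l'}G) ∘ L`
  (`partialDeriv_pull`), and the **Laplacian** `Δ(G ∘ L) = (∑_{l'} c_{l'} ∂_{l'}² G) ∘ L`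
  (`laplacian_pull`; second derivatives through `L̃` by Mathlib's
  `ContinuousLinearMap.iteratedFDeriv_comp_right`, then row-orthogonality) — this is why the
  transverse profiles of `TransverseProfile`/`TransversePeriodization` are built for the WEIGHTED
  Laplacian `𝓛_c`;
* **measure preservation** `L_* vol = vol` (`map_hom_volume`, `measurePreserving_hom`: the image
  of the Haar probability measure under a continuous surjective homomorphism of compact groups is
  the Haar probability measure — Mathlib's `isAddHaarMeasure_map_of_isFiniteMeasure` and
  `isAddHaarMeasure_eq_of_isProbabilityMeasure`), whence `∫_{𝕋^d} G(Ly) dy = ∫_{𝕋^m} G`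
  (`integral_pull`): all `L^p` norms of pulled-back profiles are those on `𝕋^m`.

The data for the directions `e_i`, `e_i ± 2e_j` of `NashGeometric.dir` and the resulting Mikado
package (`W_k = ψ_k e_k`, `div Ω_k = W_k`, CL22 Thm. 4.3) are assembled in the sibling file
`MikadoFlows`. Everything here is proved; no named facts.

## References

* A. Cheskidov, X. Luo, Invent. Math. 229 (2022) = arXiv:2009.06596, §4.1 (4.5)–(4.7), Thm. 4.3.
  [`CheskidovLuo2022`]
-/

noncomputable section

open Set Filter Topology Function MeasureTheory
open scoped ContDiff

namespace Literature.Analysis.FluidPDE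

open FunctionSpaces FunctionSpaces.Torus

/-- **Integer transverse data of a lattice direction `k ∈ ℤ^d`**: integer forms `A` (the map
`(L y)_{l'} = ∑ₗ A l l' yₗ`), weights `c`, the direction `k`, an integer section `B`, with orthogonal
rows of squared lengths `c`, `A` annihilating `k`, and `BA = 1`. [folklore] -/
structure TransverseDatum (d m : Type*) [Fintype d] [Fintype m] [DecidableEq m] where
  A : d → m → ℤ
  c : m → ℝ
  k : d → ℤ
  B : m → d → ℤ
  /-- Rows are orthogonal with squared lengths `c`. -/
  orth : ∀ l' l'' : m, ∑ l, (A l l' : ℝ) * (A l l'' : ℝ) = if l' = l'' then c l' else 0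
  /-- The forms annihilate the direction. -/
  annih : ∀ l' : m, ∑ l, A l l' * k l = 0
  /-- `B A = 1`. -/
  rightInv : ∀ l' l'' : m, ∑ l, B l' l * A l l'' = if l' = l'' then 1 else 0

namespace TransverseDatum

variable {d m : Type*} [Fintype d] [Fintype m] [DecidableEq m]
variable (T : TransverseDatum d m)

/-- The projection `ℝ → 𝕋¹` commutes with finite sums. [folklore] -/
theorem coe_sum_unitAddCircle {ι : Type*} (s : Finset ι) (f : ι → ℝ) :
    (((∑ i ∈ s, f i : ℝ)) : UnitAddCircle) = ∑ i ∈ s, ((f i : ℝ) : UnitAddCircle) := by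
  simp

/-- The transverse map `L : 𝕋^d → 𝕋^m`, `(L y)_{l'} = ∑ₗ A l l' • yₗ`, a group homomorphism. [folklore] -/
def hom : UnitAddTorus d →+ UnitAddTorus m where
  toFun y := fun l' => ∑ l, T.A l l' • y l
  map_zero' := by funext l'; simp
  map_add' y y' := by funext l'; simp [Finset.sum_add_distrib]

/-- Unfolding `L`. [folklore] -/
theorem hom_apply (y : UnitAddTorus d) (l' : m) : T.hom y l' = ∑ l, T.A l l' • y l := rfl

/-- `L` is continuous. [folklore] -/
theorem continuous_hom : Continuous T.hom := by
  refine continuous_pi fun l' => ?_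
  simp only [hom_apply]
  exact continuous_finsetSum _ fun l _ => (continuous_zsmul _).comp (continuous_apply l)

/-- The real-linear lift `L̃ : ℝ^d → ℝ^m`, `(L̃ v)_{l'} = ∑ₗ A l l' vₗ`. [folklore] -/
def lin : EuclideanSpace ℝ d →L[ℝ] EuclideanSpace ℝ m :=
  LinearMap.toContinuousLinearMap
    { toFun := fun v => WithLp.toLp 2 fun l' => ∑ l, (T.A l l' : ℝ) * v l
      map_add' := fun v w => by
        ext l'; simp [Finset.sum_add_distrib, mul_add]
      map_smul' := fun a v => by
        ext l'; simp [Finset.mul_sum, mul_left_comm] }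

/-- Unfolding `L̃`. [folklore] -/
theorem lin_apply (v : EuclideanSpace ℝ d) (l' : m) : T.lin v l' = ∑ l, (T.A l l' : ℝ) * v l := rfl

/-- **`L ∘ proj = proj ∘ L̃`** (integer coefficients descend to the torus). [folklore] -/
theorem hom_proj (y : EuclideanSpace ℝ d) : T.hom (proj y) = proj (T.lin y) := by
  funext l'
  rw [hom_apply, proj_apply, lin_apply, coe_sum_unitAddCircle]
  refine Finset.sum_congr rfl fun l _ => ?_
  rw [proj_apply, ← zsmul_eq_mul, AddCircle.coe_zsmul]

/-- `L` is onto (the integer section `B` provides preimages). [folklore] -/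
theorem hom_surjective : Surjective T.hom := by
  intro z
  refine ⟨fun l => ∑ l', T.B l' l • z l', funext fun l'' => ?_⟩
  rw [hom_apply]
  simp only [Finset.smul_sum, smul_smul]
  rw [Finset.sum_comm]
  have : ∀ l', ∑ l, (T.A l l'' * T.B l' l) • z l' = (if l' = l'' then (1 : ℤ) else 0) • z l' := fun l' => by
    rw [← Finset.sum_smul, ← T.rightInv l' l'']
    exact congrArg (· • z l') (Finset.sum_congr rfl fun l _ => mul_comm _ _)
  simp only [this, ite_smul, one_smul, zero_smul, Finset.sum_ite_eq', Finset.mem_univ, if_true]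

/-- `L̃ k = 0`: the forms annihilate the direction. [folklore] -/
theorem lin_dir : T.lin (WithLp.toLp 2 fun l => (T.k l : ℝ)) = 0 := by
  ext l'
  rw [lin_apply]
  simp only [PiLp.zero_apply]
  have := T.annih l'
  exact_mod_cast this


/-! ## Pull-back of functions along `L` -/

variable {F : Type*}

/-- The pull-back `G ∘ L` of a function on `𝕋^m` to `𝕋^d`. [folklore] -/
def pull (G : UnitAddTorus m → F) : UnitAddTorus d → F := G ∘ T.hom

/-- Unfolding `pull`. [folklore] -/
theorem pull_apply (G : UnitAddTorus m → F) (y : UnitAddTorus d) : T.pull G y = G (T.hom y) := rfl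

/-- `lift (G ∘ L) = lift G ∘ L̃`. [folklore] -/
theorem lift_pull (G : UnitAddTorus m → F) : lift (T.pull G) = lift G ∘ T.lin := by
  funext y
  simp only [lift_apply, comp_apply, pull_apply, hom_proj]

/-- `liftAt (G ∘ L) x = liftAt G (L x) ∘ L̃` (`L` is additive). [folklore] -/
theorem liftAt_pull (G : UnitAddTorus m → F) (x : UnitAddTorus d) :
    liftAt (T.pull G) x = liftAt G (T.hom x) ∘ T.lin := by
  funext v
  simp only [liftAt_apply, comp_apply, pull_apply, map_add, hom_proj]

variable [NormedAddCommGroup F] [NormedSpace ℝ F]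

/-- Pull-backs of smooth functions are smooth. [folklore] -/
theorem isSmooth_pull {G : UnitAddTorus m → F} (hG : IsSmooth G) : IsSmooth (T.pull G) := by
  unfold IsSmooth
  rw [lift_pull]
  exact hG.comp T.lin.contDiff

/-- Pull-backs of `C^n` functions are `C^n`. [folklore] -/
theorem isContDiff_pull {n : WithTop ℕ∞} {G : UnitAddTorus m → F} (hG : IsContDiff n G) : IsContDiff n (T.pull G) := by
  unfold IsContDiff
  rw [lift_pull]
  exact hG.comp T.lin.contDiff

/-- **Chain rule**: `D(G ∘ L)(x) = DG(L x) ∘ L̃`. [folklore] -/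
theorem fderiv_pull {G : UnitAddTorus m → F} (hG : IsContDiff 1 G) (x : UnitAddTorus d) :
    Torus.fderiv (T.pull G) x = (Torus.fderiv G (T.hom x)).comp T.lin := by
  rw [Torus.fderiv, Torus.fderiv, liftAt_pull]
  have hd : DifferentiableAt ℝ (liftAt G (T.hom x)) (T.lin 0) := by
    rw [map_zero]
    exact ((hG.liftAt _).differentiable one_ne_zero) _
  rw [fderiv_comp 0 hd T.lin.differentiableAt, T.lin.fderiv, map_zero]

/-- **Directional invariance**: `D(G ∘ L)(x) k = 0` for the lattice direction `k` (the pulled-back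
profiles are constant along the pipe; CL22 Thm. 4.3 (1): `div(W_k ⊗ W_k) = 0`). [folklore] -/
theorem fderiv_pull_dir {G : UnitAddTorus m → F} (hG : IsContDiff 1 G) (x : UnitAddTorus d) :
    Torus.fderiv (T.pull G) x (WithLp.toLp 2 fun l => (T.k l : ℝ)) = 0 := by
  rw [fderiv_pull T hG, ContinuousLinearMap.comp_apply, lin_dir, map_zero]

/-- `∂ₗ (G ∘ L) (x) = ∑_{l'} A l l' ∂_{l'} G (L x)`. [folklore] -/
theorem partialDeriv_pull [DecidableEq d] {G : UnitAddTorus m → F} (hG : IsContDiff 1 G) (l : d) (x : UnitAddTorus d) :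
    partialDeriv l (T.pull G) x = ∑ l', (T.A l l' : ℝ) • partialDeriv l' G (T.hom x) := by
  rw [partialDeriv_eq_fderiv_apply (T.isContDiff_pull hG) l x, fderiv_pull T hG, ContinuousLinearMap.comp_apply,
    fderiv_apply_eq_sum_partialDeriv hG]
  refine Finset.sum_congr rfl fun l' _ => ?_
  rw [lin_apply]
  congr 1
  simp [Finset.sum_ite_eq']


/-- **Laplacian of a pull-back**: `Δ(G ∘ L)(x) = ∑_{l'} c_{l'} ∂_{l'}∂_{l'} G (L x)` (rows of `A` are
orthogonal with squared lengths `c`). [folklore] -/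
theorem laplacian_pull [DecidableEq d] {G : UnitAddTorus m → F} (hG : IsSmooth G) (x : UnitAddTorus d) :
    laplacian (T.pull G) x = ∑ l', T.c l' • partialDeriv l' (partialDeriv l' G) (T.hom x) := by
  have hP : IsSmooth (T.pull G) := T.isSmooth_pull hG
  -- second derivatives along the standard basis
  rw [laplacian_eq_sum_lineDeriv_lineDeriv hP (EuclideanSpace.basisFun d ℝ) x]
  simp only [EuclideanSpace.basisFun_apply]
  simp_rw [lineDeriv_lineDeriv_eq_iteratedFDeriv hP, liftAt_pull]
  -- chain rule for the second derivative through the linear map `L̃`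
  have h2 : ∀ l : d, iteratedFDeriv ℝ 2 (liftAt G (T.hom x) ∘ ⇑T.lin) 0
      ![EuclideanSpace.single l (1 : ℝ), EuclideanSpace.single l 1] =
      iteratedFDeriv ℝ 2 (liftAt G (T.hom x)) 0 ![T.lin (EuclideanSpace.single l 1), T.lin (EuclideanSpace.single l 1)] := by
    intro l
    rw [T.lin.iteratedFDeriv_comp_right (hG.liftAt _) 0 (i := 2) (by norm_cast),
      ContinuousMultilinearMap.compContinuousLinearMap_apply, map_zero]
    congr 1
    funext i
    fin_cases i <;> rfl
  simp_rw [h2, iteratedFDeriv_two_apply]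
  -- expand `L̃ eₗ = ∑ A l l' e'_{l'}` bilinearly
  set D := fderiv ℝ (fderiv ℝ (liftAt G (T.hom x))) 0 with hD
  have hlin : ∀ l : d, T.lin (EuclideanSpace.single l 1) = ∑ l', (T.A l l' : ℝ) • EuclideanSpace.single l' (1 : ℝ) := by
    intro l
    ext l''
    rw [lin_apply]
    simp [Pi.single_apply, Finset.sum_apply, Pi.smul_apply]
  -- the diagonal second derivatives of `G`
  have hsingle : ∀ l', partialDeriv l' (partialDeriv l' G) (T.hom x) =
      D (EuclideanSpace.single l' 1) (EuclideanSpace.single l' 1) := by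
    intro l'
    have := lineDeriv_lineDeriv_eq_iteratedFDeriv hG (T.hom x) (EuclideanSpace.single l' 1)
    rw [iteratedFDeriv_two_apply] at this
    exact this
  have hstep : ∀ l : d,
      D (![T.lin (EuclideanSpace.single l 1), T.lin (EuclideanSpace.single l 1)] 0)
        (![T.lin (EuclideanSpace.single l 1), T.lin (EuclideanSpace.single l 1)] 1) =
      ∑ l', ∑ l'', ((T.A l l' : ℝ) * (T.A l l'' : ℝ)) •
        D (EuclideanSpace.single l' 1) (EuclideanSpace.single l'' 1) := by
    intro l
    simp only [Matrix.cons_val_zero, Matrix.cons_val_one, Matrix.cons_val_fin_one, hlin, map_sum, map_smul,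
      _root_.sum_apply, _root_.smul_apply, Finset.smul_sum, smul_smul]
    rw [Finset.sum_comm]
    exact Finset.sum_congr rfl fun _ _ => Finset.sum_congr rfl fun _ _ => by rw [mul_comm]
  simp_rw [hstep]
  rw [Finset.sum_comm]
  refine Finset.sum_congr rfl fun l' _ => ?_
  rw [Finset.sum_comm]
  simp_rw [← Finset.sum_smul, T.orth l', ite_smul, zero_smul, Finset.sum_ite_eq, Finset.mem_univ, if_true, hsingle]


/-! ## `L` preserves the Haar probability measures -/

/-- **`L_* vol_{𝕋^d} = vol_{𝕋^m}`**: the image of the Haar probability measure under the continuous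
surjective homomorphism `L` is a Haar probability measure, hence the Haar probability measure. [folklore] -/
theorem map_hom_volume : Measure.map T.hom (volume : Measure (UnitAddTorus d)) = volume := by
  have hm : Measurable T.hom := T.continuous_hom.measurable
  haveI : (Measure.map T.hom (volume : Measure (UnitAddTorus d))).IsAddHaarMeasure :=
    Measure.isAddHaarMeasure_map_of_isFiniteMeasure (volume : Measure (UnitAddTorus d)) T.hom
      T.continuous_hom T.hom_surjective
  haveI : IsProbabilityMeasure (Measure.map T.hom (volume : Measure (UnitAddTorus d))) :=
    Measure.isProbabilityMeasure_map hm.aemeasurable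
  exact Measure.isAddHaarMeasure_eq_of_isProbabilityMeasure _ _

/-- `L` is measure preserving between the Haar probability measures. [folklore] -/
theorem measurePreserving_hom : MeasurePreserving T.hom (volume : Measure (UnitAddTorus d)) volume :=
  ⟨T.continuous_hom.measurable, T.map_hom_volume⟩

/-- **Integrals of pull-backs**: `∫_{𝕋^d} G(L y) dy = ∫_{𝕋^m} G(z) dz`. [folklore] -/
theorem integral_pull {E : Type*} [NormedAddCommGroup E] [NormedSpace ℝ E] (G : UnitAddTorus m → E)
    (hG : AEStronglyMeasurable G volume) : ∫ y, T.pull G y = ∫ z, G z := by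
  have h := integral_map (μ := (volume : Measure (UnitAddTorus d))) T.continuous_hom.measurable.aemeasurable
    (f := G) (by rw [T.map_hom_volume]; exact hG)
  rw [T.map_hom_volume] at h
  rw [h]
  rfl

end TransverseDatum
end Literature.Analysis.FluidPDE
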